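import Summits.ResolutionOfSingularities.ResolutionOfSingularities.Theorems.FrobeniusLadderFRationalResolutionFixedPointGenerators
import Mathlib.RingTheory.Nakayama
import Mathlib.Algebra.Module.SpanRank
import HarnessLib

/-!
# Crux `FrobeniusLadder.FRationalResolution` (stmt-ResolutionOfSingularities-15317), line `redirect`,
# stub `stub_diagonalizableQuotientResolution` — homogeneous regular parameters at a fixed point in the INPUT FORMAT of the fixed-point
# lane (`Fin n → S`), and an INTRINSIC test for «all of one degree» (Veronese type)

The resolution theorems of this generation (`…FixedPointResolution.hasResolution_of_isolated_sameDegree_fixedPoints`, p840922;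
`…FixedPointResolutionModel`, p840932) take homogeneous regular parameters `x : Fin n → S` of the fixed prime as input. Under the stub's
hypothesis (`S` REGULAR) they exist (`…FixedPointGenerators`); this file repackages them and gives a checkable criterion for the
Veronese case:

* `exists_parameters_of_fixed` — `S` regular of finite type over a field, torsion grading, `𝔔` fixed: homogeneous `x₁,…,x_n ∈ 𝔔` of degrees
  `aᵢ` generating `𝔪_{S_𝔔}`, `n = dim S_𝔔` (Fin-indexed form of `exists_homogeneous_regularParameters_of_fixed`).
* ★ `exists_sameDegree_parameters_of_fixed` — if moreover every homogeneous element of `𝔔` of degree `≠ a₀` maps into `𝔪²_{S_𝔔}`, the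
  parameters can be taken ALL OF DEGREE `a₀` (Nakayama: a minimal homogeneous generating set has no member in `𝔪²`).

Honest label: helper lemmas toward ONE leaf stub (no stub, crux or summit closed). No definitions, no named facts, no sorry.
[cite: Matsumura1987, Thm. 2.3 (Nakayama); Thm. 14.2] [folklore; cite: SGA3, Exp. VIII §4–5]
-/

noncomputable section

-- single-problem summit: the doubled namespace component is forced
set_option linter.dupNamespace false

open IsLocalRing

namespace Summit.ResolutionOfSingularities.ResolutionOfSingularities.Theorems.FRationalResolution.FixedPointSameDegreeParameters

universe u w

variable {k : Type u} [Field k] {A : Type w} [DecidableEq A] [AddCommGroup A] {S : Type u}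
  [CommRing S] [Algebra k S] (𝒮 : A → Submodule k S) [GradedAlgebra 𝒮]

omit [DecidableEq A] [AddCommGroup A] [GradedAlgebra 𝒮] in
/-- A finite set of homogeneous elements, re-indexed by `Fin`. [folklore] -/
theorem exists_fin_of_finset (𝔔 : Ideal S) (t : Finset S) (hthom : ∀ s ∈ t, s ∈ 𝔔 ∧ SetLike.IsHomogeneousElem 𝒮 s) :
    ∃ (x : Fin t.card → S) (a : Fin t.card → A), (∀ i, x i ∈ 𝔔 ∧ x i ∈ 𝒮 (a i)) ∧ Set.range x = (↑t : Set S) := by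
  classical
  let x : Fin t.card → S := fun i => (t.equivFin.symm i : S)
  choose a ha using fun i : Fin t.card => (hthom _ (t.equivFin.symm i).2).2
  refine ⟨x, a, fun i => ⟨(hthom _ (t.equivFin.symm i).2).1, ha i⟩, ?_⟩
  ext s
  constructor
  · rintro ⟨i, rfl⟩
    exact (t.equivFin.symm i).2
  · intro hs
    exact ⟨t.equivFin ⟨s, hs⟩, by simp [x]⟩

/-- **Homogeneous regular parameters at a fixed point (Fin-indexed).** `S` regular of finite type over a field graded by an abelian
group, `𝔔 ⊇ S_a` (`a ≠ 0`) a prime: there are homogeneous `xᵢ ∈ 𝔔 ∩ S_{aᵢ}`, `i < n`, generating `𝔪_{S_𝔔}`, with `n = dim S_𝔔`.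
[cite: Matsumura1987, Thm. 14.2] [folklore; cite: SGA3, Exp. VIII §4–5] -/
theorem exists_parameters_of_fixed [IsRegularRing S] (𝔔 : Ideal S) [𝔔.IsPrime]
    (hfix : ∀ a : A, a ≠ 0 → ∀ s ∈ 𝒮 a, s ∈ 𝔔) :
    ∃ (n : ℕ) (x : Fin n → S) (a : Fin n → A), (∀ i, x i ∈ 𝔔 ∧ x i ∈ 𝒮 (a i)) ∧
      Ideal.span (algebraMap S (Localization.AtPrime 𝔔) '' Set.range x) = maximalIdeal (Localization.AtPrime 𝔔) ∧
      (n : WithBot ℕ∞) = ringKrullDim (Localization.AtPrime 𝔔) := by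
  obtain ⟨t, hthom, htspan, htcard⟩ := FixedPointGenerators.exists_homogeneous_regularParameters_of_fixed 𝒮 𝔔 hfix
  obtain ⟨x, a, hxa, hrange⟩ := exists_fin_of_finset 𝒮 𝔔 t hthom
  exact ⟨t.card, x, a, hxa, by rw [hrange, htspan], htcard⟩

/-- **Nakayama at a fixed point: a minimal homogeneous generating set has no member in `𝔪²`.** If `t` is a finite set whose image
generates `𝔪 = 𝔪_{S_𝔔}` with `|t| = spanFinrank 𝔪`, then no `s ∈ t` maps into `𝔪²`. [cite: Matsumura1987, Thm. 2.3] -/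
theorem not_mem_sq_of_minimal [IsNoetherianRing S] (𝔔 : Ideal S) [𝔔.IsPrime] (t : Finset S)
    (htspan : Ideal.span (algebraMap S (Localization.AtPrime 𝔔) '' (↑t : Set S)) = maximalIdeal (Localization.AtPrime 𝔔))
    (htcard : t.card = (maximalIdeal (Localization.AtPrime 𝔔)).spanFinrank) {s : S} (hs : s ∈ t) :
    algebraMap S (Localization.AtPrime 𝔔) s ∉ (maximalIdeal (Localization.AtPrime 𝔔)) ^ 2 := by
  classical
  intro hs2
  haveI : IsNoetherianRing (Localization.AtPrime 𝔔) :=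
    IsLocalization.isNoetherianRing 𝔔.primeCompl (Localization.AtPrime 𝔔) inferInstance
  -- the smaller generating set
  set N : Ideal (Localization.AtPrime 𝔔) :=
    Ideal.span (algebraMap S (Localization.AtPrime 𝔔) '' (↑(t.erase s) : Set S)) with hN
  have hle : maximalIdeal (Localization.AtPrime 𝔔) ≤
      N ⊔ maximalIdeal (Localization.AtPrime 𝔔) • maximalIdeal (Localization.AtPrime 𝔔) := by
    calc maximalIdeal (Localization.AtPrime 𝔔)
        = Ideal.span (algebraMap S (Localization.AtPrime 𝔔) '' (↑t : Set S)) := htspan.symm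
      _ ≤ N ⊔ maximalIdeal (Localization.AtPrime 𝔔) • maximalIdeal (Localization.AtPrime 𝔔) := by
        refine Ideal.span_le.mpr ?_
        rintro _ ⟨u, hu, rfl⟩
        by_cases hus : u = s
        · subst hus
          refine Ideal.mem_sup_right ?_
          rw [Ideal.smul_eq_mul, ← pow_two]
          exact hs2
        · exact Ideal.mem_sup_left (Ideal.subset_span ⟨u, Finset.mem_erase.mpr ⟨hus, hu⟩, rfl⟩)
  set 𝔪 := maximalIdeal (Localization.AtPrime 𝔔) with h𝔪
  have hN𝔪 : 𝔪 ≤ N :=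
    Submodule.le_of_le_smul_of_le_jacobson_bot (IsNoetherian.noetherian 𝔪) (maximalIdeal_le_jacobson ⊥) hle
  have hN𝔪' : N ≤ 𝔪 := by
    rw [← htspan]
    exact Ideal.span_mono (Set.image_mono (Finset.coe_subset.mpr (Finset.erase_subset s t)))
  have hNeq : N = 𝔪 := le_antisymm hN𝔪' hN𝔪
  -- count generators
  have hfin : ((↑(t.erase s) : Set S)).Finite := (t.erase s).finite_toSet
  have h1 : 𝔪.spanFinrank ≤ (t.erase s).card := by
    rw [← hNeq, hN]
    refine (Submodule.spanFinrank_span_le_ncard_of_finite (hfin.image _)).trans ?_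
    refine (Set.ncard_image_le hfin).trans ?_
    rw [Set.ncard_coe_finset]
  rw [Finset.card_erase_of_mem hs, htcard] at h1
  have h2 : 0 < t.card := Finset.card_pos.mpr ⟨s, hs⟩
  omega

/-- ★ **Veronese-type fixed points: parameters of ONE degree.** `S` regular of finite type over a field graded by an abelian group,
`𝔔 ⊇ S_a` (`a ≠ 0`) a prime, `a₀ : A`; if every homogeneous element of `𝔔` of degree `≠ a₀` maps into `𝔪²_{S_𝔔}`, there are homogeneous
`x₁,…,x_n ∈ 𝔔`, ALL OF DEGREE `a₀`, generating `𝔪_{S_𝔔}`, with `n = dim S_𝔔` — the input of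
`…FixedPointResolution.hasResolution_of_isolated_sameDegree_fixedPoints`. [cite: Matsumura1987, Thm. 2.3; Thm. 14.2] -/
theorem exists_sameDegree_parameters_of_fixed [IsRegularRing S] (𝔔 : Ideal S) [𝔔.IsPrime]
    (hfix : ∀ a : A, a ≠ 0 → ∀ s ∈ 𝒮 a, s ∈ 𝔔) (a₀ : A)
    (hdeg : ∀ a : A, a ≠ a₀ → ∀ s ∈ 𝒮 a, s ∈ 𝔔 →
      algebraMap S (Localization.AtPrime 𝔔) s ∈ (maximalIdeal (Localization.AtPrime 𝔔)) ^ 2) :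
    ∃ (n : ℕ) (x : Fin n → S), (∀ i, x i ∈ 𝔔 ∧ x i ∈ 𝒮 a₀) ∧
      Ideal.span (algebraMap S (Localization.AtPrime 𝔔) '' Set.range x) = maximalIdeal (Localization.AtPrime 𝔔) ∧
      (n : WithBot ℕ∞) = ringKrullDim (Localization.AtPrime 𝔔) := by
  obtain ⟨t, hthom, htspan, htcard⟩ := FixedPointGenerators.exists_homogeneous_minimal_generators_of_fixed 𝒮 𝔔 hfix
  haveI : IsRegularLocalRing (Localization.AtPrime 𝔔) := IsRegularRing.isRegularLocalRing_localization 𝔔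
  -- every member of `t` has degree `a₀`
  have hdeg_t : ∀ s ∈ t, s ∈ 𝔔 ∧ s ∈ 𝒮 a₀ := by
    intro s hs
    obtain ⟨hs𝔔, a, ha⟩ := hthom s hs
    refine ⟨hs𝔔, ?_⟩
    by_cases haa : a = a₀
    · exact haa ▸ ha
    · exact absurd (hdeg a haa s ha hs𝔔) (not_mem_sq_of_minimal 𝔔 t htspan htcard hs)
  obtain ⟨x, a, hxa, hrange⟩ := exists_fin_of_finset 𝒮 𝔔 t (fun s hs => ⟨(hdeg_t s hs).1, a₀, (hdeg_t s hs).2⟩)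
  refine ⟨t.card, x, fun i => ?_, by rw [hrange, htspan], ?_⟩
  · have hi : x i ∈ (↑t : Set S) := hrange ▸ Set.mem_range_self i
    exact hdeg_t (x i) hi
  · rw [htcard]
    exact IsRegularLocalRing.spanFinrank_maximalIdeal

end Summit.ResolutionOfSingularities.ResolutionOfSingularities.Theorems.FRationalResolution.FixedPointSameDegreeParameters

end
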